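import Literature.MathematicalPhysics.QuantumFieldTheory.Balaban1983to89.Node00.BackgroundSelOfRecord
import Literature.MathematicalPhysics.QuantumFieldTheory.Balaban1983to89.B11Claim309UAnalytic

/-!
# NODE 00 — `BackgroundMapOfRecord`: P0 «[B11] Theorem 1 AS A NAMED MAP» AT THE RECORD — the Prop. 6 contraction scheme of
# [Balaban1985Variational] PRESENTED at the record's lattice objects, its DISPLAYED (11′)-tokens, and the factorisation
# `UkSel = rootGauge ∘ (chart image of the fixed point)` PROVED from them; parameter-analyticity of the fixed point BY NAME

Cell `pub-ymgap` (YM-PLAN Track A), seat `pub-ymgap-node00-def-Y` (g35; OWNER ∕ CUSTODIAN desk of the Node00 operator layer), answering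
★★★ director-ym №509 (A)(B) and ★★ dag-lead WORDS 634 (1)(a) (2026-08-31): the THREE discharge-time blocks of the night (Tok-182 ∕ T‴, (R4ᴰ)′,
`stub_LZ`) all read through the selector `UkSel` and hit ONE wall, **P0 := [B11] Thm 1 as a NAMED MAP with analytic dependence**; this file is the
Node00 record edition placing P0's ingredients BY NAME.  [B11] = [Balaban1985Variational] (CMP **102** (1985) 277–309), [I] = [Balaban1987RG1]
(CMP **109**), [B9] = [Balaban1985BackgroundPropagators] (CMP **99**).  APPEND-ONLY: a NEW importing module; nothing landed is edited, no carrier of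
record re-pointed; count-neutral; filed `--supports stmt-QuantumFields-27238` (K0ᴬ — the decay road's P0, ★★ dag-lead WORDS 637).  READERS BY
NAME: ▶ PTA-1's `stub_LZ` (α) of stmt-QuantumFields-27930 (through dag-n07-w3's Summit-side knit `…/BalabanUVNodesN07P0FixedPointIsRecordMinimiser`),
★ PTB-1's Tok-182 ∕ T‴ consumability of stmt-QuantumFields-27931, ◇ lens-1's (R4ᴰ)′ JOIN road.

WHAT THE TREE ALREADY HAS (census of record, this seat, 2026-08-31 — cited BY NAME, not re-typed):
* the SCHEME of [B11] Prop. 6 ∕ Sects. E–G over abstract complete complex carriers: `B11Prop6Scheme.mapT` (the map of (116) on the closed ball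
  ‖X‖ ≤ ε₄ of (115)), `lipschitz_120` (the contraction inequality (120)), `existsUnique_solution` (Banach), and `B11Eq174Chart.{solA, Regime,
  Regime.ofProp6, chartH}`;
* PARAMETER-ANALYTICITY of the selected fixed point, `B11Claim309UAnalytic.analyticOnNhd_solA`: a UNIFORM `Regime` on an open set `𝒪` of any complete
  complex space `𝒰` and data `𝒢, Λ, W, J, 𝔄` analytic on `𝒪` give `u ↦ solA …` analytic on `𝒪` (p. 309 + the Prop. 9 clause «analytic in B and in U»);
* the selector of record with its CANONICITY: `UkSel F N K k ε := rootGauge k ∘ (a measurable choice of (0.21) minimisers)` and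
  `rootGauge_eq_UkSel_of_isBackground` («under `UniqueUkOrbit … V` EVERY minimiser `U₀` over `V` has `rootGauge k U₀ = UkSel … V`»,
  `Node00/BackgroundSelOfRecord`), the clauses `UkExists`, `UniqueUkOrbit` (`Node00/BackgroundActionOfRecord`), `rootGauge_eq_of_orbitRel`
  (`T4RootedResidualGauge`), the retraction `suOfMat`.
WHAT THE TREE DOES NOT HAVE (and this file does NOT construct — it DISPLAYS): a lattice INSTANCE of the Prop. 6 data at `F.P K` (the propagator 𝔊(U₀)
of [B9], `W = (δ∕δA′)V` of (80)∕(98), the current `J` of (28)∕(114), the (115)-normed space), the theorem «the chart image of the fixed point is a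
(0.21)-minimiser over V» (Prop. 7 p. 299 from a background (14) + the minimality sentence (141)–(142) + Prop. 8), and Thm 1's uniqueness on the
(7)-domain.  They enter below as DATA (`BgScheme`) and as NAMED HYPOTHESES (`RegimeTok`, `ChartSUTok`, `Prop7Tok`, `UniqTok`) — the honest (11′)-tokens
of №508∕№509 — never asserted.

WHAT IS CERTIFIED (kernel, sorry-free; axioms `propext` ∕ `Classical.choice` ∕ `Quot.sound`; no instance, no notation, no named fact asserted).
§1 `BgScheme F N 𝒴 𝒵 K k` — the Prop. 6 DATA at the record (pattern of n09-b's `Node00/CarriersB12Chart.ChartB12Run`): the (7)-domain `dom` of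
   coarse fields `V`, the background `bg : V ↦ U₀` of (14), the data `𝒢 W J 𝔄 : V ↦ …` of (116) (no linear term, `Λ = 0`, as in (116)∕(175)), the
   regime constants `B₀ C₄ a₃ j a ε₄`, and the PRESENTATION `ev : 𝒴 →ₗ[ℂ] (bonds → M_N(ℂ))` of the (115)-space as the exponent `X = ηA′` itself
   ([B11] (19); `T3SectALandauChart.In19`'s η-free convention «U₁(b) = exp(iX(b))»).
§2 letters with bodies: `BgScheme.sol S V := solA (S.𝒢 V) 0 (S.W V) (S.J V) S.ε₄ (S.𝔄 V)` (the selected fixed point 𝒜 of (116)), `expo S V b :=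
   exp(i · ev(𝒜 + 𝔄)(b))`, `chartCfg S V := (b ↦ suOfMat (expo S V b) · U₀(b))` — the Sect. B∕C chart «U = U′U₀, U′ = exp(iηA′)» ((15), (26)–(28)) READ
   through the total retraction `suOfMat` (identity on SU(N)); the retraction-free RELATION `IsChartImage S V U` («U(b) = exp(iX(b))·U₀(b)») with
   `isChartImage_chartCfg` ∕ `IsChartImage.eq_chartCfg` (on `SU(N)`-valued exponents the two agree and the image is unique).
§3 the DISPLAYED TOKENS (each `def … : Prop`, docstring = the printed leaf it stands for): `RegimeTok` (Prop. 6 (117)–(121) at the instance ⇐ [B9]'s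
   Green-operator bound (117), Prop. 4 (98), the current bound (28)∕(114)), `ChartSUTok` (the exponent of the fixed point is `su(N)`-valued for the
   real data: `expo S V b ∈ SU(N)`), `Prop7Tok` («U_k = (U₁U₀)^u», p. 299: some gauge transform of the chart image IS a (0.21)-minimiser over `V` in
   `bgReg … ε`), `UniqTok` (Thm 1's uniqueness clause (6) on the domain, = `UniqueUkOrbit`; socket `B11Thm1.Unique6` ∕
   `B11Thm1CarrierTReg.uniqueUkOrbitR_of_unique6`).
§4 PROVED — THE FACTORISATION: `ukExists_of_prop7Tok`; ★ `UkSel_eq_rootGauge_of_isBackground_chart` (for EVERY gauge transform `u` making the chart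
   image a minimiser, `UkSel … V = rootGauge k (chartCfg S V)^u`); ★ `exists_UkSel_eq_rootGauge_chart` (under `Prop7Tok` + `UniqTok`, on the domain);
   `UkSel_eq_rootGauge_chartCfg_of_orbitRel` (if that `u` is RESIDUAL of level `k`, `UkSel … V = rootGauge k (chartCfg S V)` itself).
§5 PROVED — P0's ANALYTIC DEPENDENCE AT THE RECORD, by name: for any complete complex parameter space `𝒰`, open `𝒪`, parametrisation
   `γ : 𝒰 → (coarse fields)` mapping `𝒪` into `dom`, `RegimeTok` + analyticity on `𝒪` of the data maps `S.𝒢 ∘ γ`, `S.J ∘ γ`, `S.𝔄 ∘ γ` and joint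
   analyticity of `(u, Y) ↦ S.W (γ u) Y` give `AnalyticOnNhd ℂ (fun u => S.sol (γ u)) 𝒪` (`analyticOnNhd_sol_comp` = `analyticOnNhd_solA`) — «all
   chart variables» = whatever `𝒰` parametrises (background data, coarse field, both, complexified).

HONEST SCOPE.  A NAMES + TOKENS edition: P0's CONTENT — the lattice instance of `BgScheme` with `RegimeTok` (i.e. [B9]'s propagator bounds and
Prop. 4 at the record), `Prop7Tok` (Prop. 7 + (141)–(142) + Prop. 8 at the instance) and `UniqTok` (Thm 1 (6)) — is OPEN in the tree and DISPLAYED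
here; nothing of Bałaban is asserted; the data-analyticity premises of §5 are hypotheses.  No continuum ∕ OS ∕ Clay statement is touched; the
Yang–Mills mass gap is NOT proved by any of this.
-/

open Set

namespace Literature.MathematicalPhysics.QuantumFieldTheory.Balaban1983to89.Node00

open T4Continuum (T4Family)
open B12GaugeOrbits021 (OrbitRel)
open T4RootedResidualGauge (rootGauge rootGauge_eq_of_orbitRel)
open B11Eq174Chart (Regime solA)
open B11Claim309UAnalytic (analyticOnNhd_solA)
open GaugeField (gaugeAct)
open NormedSpace (exp)

variable (F : T4Family) (N : ℕ)
variable (𝒴 𝒵 : Type) [NormedAddCommGroup 𝒴] [NormedSpace ℂ 𝒴] [NormedAddCommGroup 𝒵] [NormedSpace ℂ 𝒵]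

/-! ## §1. The Prop. 6 data at the record -/

/-- **THE [B11] PROP. 6 SCHEME AT THE RECORD, AS DATA** (`K`-th lattice, level `k`): the (7)-domain `dom` of coarse fields `V` on `T^{(k)}`; the
background `bg V = U₀` of (14) (print: supplied by Theorem 1 at level `k − 1`, «for k = 1 … U₀ = V₀»); the data of the equation (116)
`X = −𝒢J − 𝒢W(X + 𝔄)` around `U₀` — the propagator `𝒢 V = 𝔊(U₀)` of [B9], the higher-order term `W V = (δ∕δA′)V` of (80)∕(98), the current `J V` of
(26)–(28)∕(114), the shift `𝔄 V` — over abstract complete complex carriers `𝒴` ((115)-normed small fields), `𝒵` (currents); the regime constants of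
Prop. 6 (`B₀` of (117), `C₄, a₃` of (98), the bounds `j, a` on `J, 𝔄`, the radius `ε₄` of (115)); and the PRESENTATION `ev` of `𝒴` as bond functions
`X = ηA′ : bonds of T_η → M_N(ℂ)` (the exponent of (19), η-free convention of `T3SectALandauChart.In19`).  DATA ONLY: no law is a field; the printed laws
are the tokens of §3.  NO lattice instance exists in the tree (census 2026-08-31). [cite: Balaban1985Variational, Prop. 6 (115)–(121) p.295, (14) p.280, (26)–(28) p.282] -/
structure BgScheme (K k : ℕ) where
  /-- the (7)-domain of coarse fields `V` («V satisfying (7) with ε₁ ≤ a₁») -/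
  dom : Set (GaugeField (F.P K) k (SU N))
  /-- the background `U₀` of (14) around which the chart is taken -/
  bg : GaugeField (F.P K) k (SU N) → GaugeField (F.P K) 0 (SU N)
  /-- [B11]'s `𝒢 = 𝔊(U₀)` of (116) ([B9]'s propagator at the background) -/
  𝒢 : GaugeField (F.P K) k (SU N) → (𝒵 →L[ℂ] 𝒴)
  /-- [B11]'s `W = (δ∕δA′)V` of (116) (at least second order, (98)) -/
  W : GaugeField (F.P K) k (SU N) → 𝒴 → 𝒵
  /-- the current `J` of (116) ((26)–(28), (114)) -/
  J : GaugeField (F.P K) k (SU N) → 𝒵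
  /-- the shift `𝔄` of (116) (`X + 𝔄 = A′`) -/
  𝔄 : GaugeField (F.P K) k (SU N) → 𝒴
  /-- the regime constants of Prop. 6: `B₀` (117), `C₄, a₃` (98), the bounds `j ≥ |J|`, `a > |𝔄|`, the radius `ε₄` of (115) -/
  (B₀ C₄ a₃ j a ε₄ : ℝ)
  /-- the presentation of the (115)-space as the exponents `X = ηA′` on the bonds of `T_η` -/
  ev : 𝒴 →ₗ[ℂ] (PBond (F.P K) 0 → Matrix (Fin N) (Fin N) ℂ)

namespace BgScheme

variable {F N 𝒴 𝒵} {K k : ℕ}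
variable (S : BgScheme F N 𝒴 𝒵 K k)

/-! ## §2. Letters with bodies: the fixed point, its exponent, the chart image -/

/-- **`𝒜(V)` — THE SELECTED FIXED POINT of (116)** around `U₀ = bg V`: `solA (𝒢 V) 0 (W V) (J V) ε₄ (𝔄 V)` (the tree's selected solution of
`X = −𝒢J − 𝒢W(X + 𝔄)` in ‖X‖ ≤ ε₄; under `RegimeTok` it is THE unique solution, `B11Prop6Scheme.existsUnique_solution`).
[cite: Balaban1985Variational, Prop. 6 (116) p.295] -/
noncomputable def sol (V : GaugeField (F.P K) k (SU N)) : 𝒴 :=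
  solA (S.𝒢 V) 0 (S.W V) (S.J V) S.ε₄ (S.𝔄 V)

/-- **The exponent of the chart image on a bond**: `exp(i X(b))`, `X = ev(𝒜(V) + 𝔄(V))` (the full small field `A′ = 𝒜 + 𝔄` presented as `ηA′`).
[cite: Balaban1985Variational, (15) p.280, (19) p.281] -/
noncomputable def expo (V : GaugeField (F.P K) k (SU N)) (b : PBond (F.P K) 0) : Matrix (Fin N) (Fin N) ℂ :=
  exp (Complex.I • S.ev (S.sol V + S.𝔄 V) b)

/-- **THE CHART IMAGE OF THE FIXED POINT** — «U = U′U₀, U′ = exp(iηA′)» ((15), Sect. B (26)–(28)) read through the total retraction `suOfMat`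
(identity on `SU(N)`, `suOfMat_of_mem`; the unit elsewhere — documented junk off `ChartSUTok`). [cite: Balaban1985Variational, (15) p.280, (26)–(28) p.282] -/
noncomputable def chartCfg (V : GaugeField (F.P K) k (SU N)) : GaugeField (F.P K) 0 (SU N) :=
  fun b => suOfMat N (S.expo V b) * S.bg V b

/-- Unfolding of the chart image on a bond. [cite: Balaban1985Variational, (15) p.280] -/
theorem chartCfg_apply (V : GaugeField (F.P K) k (SU N)) (b : PBond (F.P K) 0) :
    S.chartCfg V b = suOfMat N (S.expo V b) * S.bg V b := rfl

/-- On `ChartSUTok`'s bonds the retraction is transparent: the matrix of `chartCfg S V b` is `exp(iX(b)) · U₀(b)`.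
[cite: Balaban1985Variational, (15) p.280] -/
theorem coe_chartCfg_of_mem {V : GaugeField (F.P K) k (SU N)} {b : PBond (F.P K) 0}
    (h : S.expo V b ∈ Matrix.specialUnitaryGroup (Fin N) ℂ) :
    ((S.chartCfg V b : SU N) : Matrix (Fin N) (Fin N) ℂ) = S.expo V b * ((S.bg V b : SU N) : Matrix (Fin N) (Fin N) ℂ) := by
  rw [chartCfg_apply, suOfMat_of_mem h]
  rfl

/-- **THE CHART RELATION** «U = U′U₀, U′ = exp(iηA′)» between a configuration `U` and the fixed point at `V`, stated on the matrices (no retraction):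
`U(b) = exp(iX(b)) · U₀(b)` on every bond. [cite: Balaban1985Variational, (15) p.280, (26)–(28) p.282] -/
def IsChartImage (V : GaugeField (F.P K) k (SU N)) (U : GaugeField (F.P K) 0 (SU N)) : Prop :=
  ∀ b : PBond (F.P K) 0, ((U b : SU N) : Matrix (Fin N) (Fin N) ℂ) = S.expo V b * ((S.bg V b : SU N) : Matrix (Fin N) (Fin N) ℂ)

/-- When the exponent is `SU(N)`-valued on every bond (the bonds of `ChartSUTok`), `chartCfg S V` IS a chart image of the fixed point.
[cite: Balaban1985Variational, (15) p.280] -/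
theorem isChartImage_chartCfg {V : GaugeField (F.P K) k (SU N)} (h : ∀ b : PBond (F.P K) 0, S.expo V b ∈ Matrix.specialUnitaryGroup (Fin N) ℂ) :
    S.IsChartImage V (S.chartCfg V) :=
  fun b => S.coe_chartCfg_of_mem (h b)

/-- A chart image is unique: it equals `chartCfg S V` (the `SU(N)`-valued field is determined by its matrices). [cite: Balaban1985Variational, (15) p.280] -/
theorem IsChartImage.eq_chartCfg {V : GaugeField (F.P K) k (SU N)} {U : GaugeField (F.P K) 0 (SU N)} (hU : S.IsChartImage V U)
    (h : ∀ b : PBond (F.P K) 0, S.expo V b ∈ Matrix.specialUnitaryGroup (Fin N) ℂ) : U = S.chartCfg V := by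
  funext b
  exact Subtype.ext ((hU b).trans (S.coe_chartCfg_of_mem (h b)).symm)

/-! ## §3. The displayed tokens (named hypotheses; never asserted) -/

/-- **TOKEN (Prop. 6 at the instance)** — the printed hypotheses (117)–(121) of the contraction hold for the data at every `V` of the domain:
the regime (`B11Eq174Chart.Regime`, θ = 0, Λ = 0) and the bounds `‖J V‖ ≤ j`, `‖𝔄 V‖ < a`.  In print: (117) is [B9]'s bound on 𝔊, the quadratic
bound on `W` is Prop. 4 (98), the current bound is (28)∕(114); the arithmetic (118)–(121) is `Regime.ofProp6`.  OPEN at the record (no instance).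
[cite: Balaban1985Variational, Prop. 6 (117)–(121) p.295, Prop. 4 (98) p.293, (28) p.282] -/
def RegimeTok : Prop :=
  ∀ V ∈ S.dom, Regime (S.𝒢 V) 0 (S.W V) S.B₀ 0 S.C₄ S.a₃ S.j S.a S.ε₄ ∧ ‖S.J V‖ ≤ S.j ∧ ‖S.𝔄 V‖ < S.a

/-- **TOKEN (reality of the fixed point)** — for the real data of the domain the exponent `X = ev(𝒜 + 𝔄)` is `su(N)`-valued, so `exp(iX(b)) ∈ SU(N)`
on every bond (print: the solution of the real equation is real; the complex carriers serve Prop. 9's analytic extension to `Gᶜ`-valued fields).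
[cite: Balaban1985Variational, Prop. 6 p.295, Prop. 9 p.309] -/
def ChartSUTok : Prop :=
  ∀ V ∈ S.dom, ∀ b : PBond (F.P K) 0, S.expo V b ∈ Matrix.specialUnitaryGroup (Fin N) ℂ

variable [NeZero N]

/-- **TOKEN (Prop. 7 at the instance)** — «It is a critical configuration of the functional (5). To see that U_k is a minimum …» (p. 299) with
«U_k = (U₁U₀)^u»: SOME gauge transform of the chart image of the fixed point IS a (0.21)-minimiser over `V` within `bgReg … ε` (`Setup.IsBackground`
along the averaging of record) — Prop. 7 from a background (14), the minimality sentence (141)–(142), and Prop. 8 (membership in the space (8)).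
OPEN at the record. [cite: Balaban1985Variational, Prop. 7 p.299, (141)–(142) p.299, Prop. 8 p.304] -/
def Prop7Tok (ε : ℝ) : Prop :=
  ∀ V ∈ S.dom, ∃ u : GaugeTransf (F.P K) 0 (SU N),
    IsBackground (avOfRecord F N K) (bgReg F N K k ε) k V (gaugeAct u (S.chartCfg V))

/-- **TOKEN (Theorem 1's uniqueness clause on the domain)** — «This orbit is a unique critical orbit in the space (6) if B₃ε₁ ≦ ε₀ and ε₀ ≦ a₀»:
`UniqueUkOrbit … V` for every `V` of the domain (socket to the typed clause: `B11Thm1.Unique6`, `B11Thm1CarrierTReg.uniqueUkOrbitR_of_unique6`).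
OPEN at the record. [cite: Balaban1985Variational, Thm 1 p.279] -/
def UniqTok (ε : ℝ) : Prop :=
  ∀ V ∈ S.dom, UniqueUkOrbit F N K k ε V

/-! ## §4. The factorisation `UkSel = rootGauge ∘ (chart image of the fixed point)` -/

variable {S} {ε : ℝ}

/-- Under `Prop7Tok` the variational problem (0.21) is solvable on the domain (`UkExists`). [cite: Balaban1985Variational, Thm 1 (8) p.279] -/
theorem ukExists_of_prop7Tok (h7 : S.Prop7Tok ε) {V : GaugeField (F.P K) k (SU N)} (hV : V ∈ S.dom) : UkExists F N K k ε V := by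
  obtain ⟨u, hu⟩ := h7 V hV
  exact ⟨_, hu⟩

/-- **★ THE FACTORISATION, pointwise form**: whenever a gauge transform `u` of the chart image of the fixed point is a (0.21)-minimiser over `V` and
the minimal orbit over `V` is unique, the selector of record IS its rooted gauge: `UkSel … V = rootGauge k ((chartCfg S V)^u)` — no calculus of the
selector is involved (`rootGauge_eq_UkSel_of_isBackground`). [cite: Balaban1985Variational, Thm 1 p.279, p.299 («U_k = (U₁U₀)^u»)] -/
theorem UkSel_eq_rootGauge_of_isBackground_chart (hk : k ≤ (F.P K).m + (F.P K).K) {V : GaugeField (F.P K) k (SU N)}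
    (hu : UniqueUkOrbit F N K k ε V) {u : GaugeTransf (F.P K) 0 (SU N)}
    (h₀ : IsBackground (avOfRecord F N K) (bgReg F N K k ε) k V (gaugeAct u (S.chartCfg V))) :
    UkSel F N K k ε V = rootGauge k (gaugeAct u (S.chartCfg V)) :=
  (rootGauge_eq_UkSel_of_isBackground hk hu h₀).symm

/-- **★ THE FACTORISATION ON THE DOMAIN**: under `Prop7Tok` and `UniqTok`, for every `V` of the domain there is a gauge transform `u` with
`(chartCfg S V)^u` a (0.21)-minimiser over `V` and `UkSel … V = rootGauge k ((chartCfg S V)^u)` — P0's «`UkSel V` = rootGauge of the chart image of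
the `mapT` fixed point», modulo the displayed tokens. [cite: Balaban1985Variational, Thm 1 p.279, Prop. 7 p.299] -/
theorem exists_UkSel_eq_rootGauge_chart (hk : k ≤ (F.P K).m + (F.P K).K) (h7 : S.Prop7Tok ε) (hU : S.UniqTok ε)
    {V : GaugeField (F.P K) k (SU N)} (hV : V ∈ S.dom) :
    ∃ u : GaugeTransf (F.P K) 0 (SU N), IsBackground (avOfRecord F N K) (bgReg F N K k ε) k V (gaugeAct u (S.chartCfg V)) ∧
      UkSel F N K k ε V = rootGauge k (gaugeAct u (S.chartCfg V)) := by
  obtain ⟨u, hu⟩ := h7 V hV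
  exact ⟨u, hu, UkSel_eq_rootGauge_of_isBackground_chart hk (hU V hV) hu⟩

/-- **If the transform is RESIDUAL of level `k`** (`OrbitRel k (chartCfg S V) ((chartCfg S V)^u)`), the rooted gauge forgets it:
`UkSel … V = rootGauge k (chartCfg S V)`. [cite: Balaban1985Variational, Thm 1 p.279, (19) p.281] -/
theorem UkSel_eq_rootGauge_chartCfg_of_orbitRel (hk : k ≤ (F.P K).m + (F.P K).K) {V : GaugeField (F.P K) k (SU N)}
    (hu : UniqueUkOrbit F N K k ε V) {u : GaugeTransf (F.P K) 0 (SU N)}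
    (h₀ : IsBackground (avOfRecord F N K) (bgReg F N K k ε) k V (gaugeAct u (S.chartCfg V)))
    (hrel : OrbitRel k (S.chartCfg V) (gaugeAct u (S.chartCfg V))) :
    UkSel F N K k ε V = rootGauge k (S.chartCfg V) := by
  rw [UkSel_eq_rootGauge_of_isBackground_chart hk hu h₀, rootGauge_eq_of_orbitRel hrel]

/-- The minimiser produced by the tokens is, in the rooted gauge, independent of every choice (selector, gauge transform): any two gauge transforms
`u, u′` making the chart image a minimiser give the same rooted configuration. [cite: Balaban1985Variational, Thm 1 p.279] -/
theorem rootGauge_chart_eq_of_isBackground (hk : k ≤ (F.P K).m + (F.P K).K) {V : GaugeField (F.P K) k (SU N)}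
    (hu : UniqueUkOrbit F N K k ε V) {u u' : GaugeTransf (F.P K) 0 (SU N)}
    (h₀ : IsBackground (avOfRecord F N K) (bgReg F N K k ε) k V (gaugeAct u (S.chartCfg V)))
    (h₀' : IsBackground (avOfRecord F N K) (bgReg F N K k ε) k V (gaugeAct u' (S.chartCfg V))) :
    rootGauge k (gaugeAct u (S.chartCfg V)) = rootGauge k (gaugeAct u' (S.chartCfg V)) := by
  rw [rootGauge_eq_UkSel_of_isBackground hk hu h₀, rootGauge_eq_UkSel_of_isBackground hk hu h₀']

/-! ## §5. P0's analytic dependence at the record, by name -/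

omit [NeZero N] in
/-- **★ «THE EQUATIONS DETERMINE AN ANALYTIC FUNCTION» AT THE RECORD**: along any parametrisation `γ` of the domain by an open set `𝒪` of a complete
complex space `𝒰` (the chart variables: background data, coarse field, both — complexified as the consumer needs), the uniform regime `RegimeTok`
and analyticity on `𝒪` of the data maps `S.𝒢 ∘ γ`, `S.J ∘ γ`, `S.𝔄 ∘ γ`, joint analyticity of `(u, Y) ↦ S.W (γ u) Y` on `𝒪 × {‖Y‖ < a₃}`, give
ANALYTICITY of the fixed point `u ↦ 𝒜(γ u)` on `𝒪` (`B11Claim309UAnalytic.analyticOnNhd_solA`: «the fixed point of a uniformly contracting analytic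
family is analytic in the parameter»).  The data-analyticity premises are [B9]'s ∕ Prop. 4's analyticity sentences at the instance — hypotheses here.
[cite: Balaban1985Variational, p.309, Prop. 9 p.309, Prop. 6 p.296] -/
theorem analyticOnNhd_sol_comp [CompleteSpace 𝒴] [CompleteSpace 𝒵]
    {𝒰 : Type*} [NormedAddCommGroup 𝒰] [NormedSpace ℂ 𝒰] [CompleteSpace 𝒰] {𝒪 : Set 𝒰} (h𝒪 : IsOpen 𝒪)
    {γ : 𝒰 → GaugeField (F.P K) k (SU N)} (hγ : MapsTo γ 𝒪 S.dom) (hR : S.RegimeTok)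
    (h𝒢 : AnalyticOnNhd ℂ (fun u => S.𝒢 (γ u)) 𝒪)
    (hW : AnalyticOnNhd ℂ (fun p : 𝒰 × 𝒴 => S.W (γ p.1) p.2) (𝒪 ×ˢ {Y : 𝒴 | ‖Y‖ < S.a₃}))
    (hJ : AnalyticOnNhd ℂ (fun u => S.J (γ u)) 𝒪) (h𝔄 : AnalyticOnNhd ℂ (fun u => S.𝔄 (γ u)) 𝒪) :
    AnalyticOnNhd ℂ (fun u => S.sol (γ u)) 𝒪 :=
  analyticOnNhd_solA (𝒢 := fun u => S.𝒢 (γ u)) (Λ := fun _ => (0 : 𝒴 →L[ℂ] 𝒴)) (W := fun u => S.W (γ u))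
    (J := fun u => S.J (γ u)) (𝔄 := fun u => S.𝔄 (γ u)) h𝒪
    (fun u hu => (hR (γ u) (hγ hu)).1) (fun u hu => (hR (γ u) (hγ hu)).2.1) (fun u hu => (hR (γ u) (hγ hu)).2.2)
    h𝒢 (fun _ _ => analyticAt_const) hW hJ h𝔄

omit [NeZero N] in
/-- The full small field `u ↦ 𝒜(γ u) + 𝔄(γ u)` (the exponent before presentation) is analytic on `𝒪` under the same premises.
[cite: Balaban1985Variational, Prop. 9 p.309] -/
theorem analyticOnNhd_sol_add_shift_comp [CompleteSpace 𝒴] [CompleteSpace 𝒵]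
    {𝒰 : Type*} [NormedAddCommGroup 𝒰] [NormedSpace ℂ 𝒰] [CompleteSpace 𝒰] {𝒪 : Set 𝒰} (h𝒪 : IsOpen 𝒪)
    {γ : 𝒰 → GaugeField (F.P K) k (SU N)} (hγ : MapsTo γ 𝒪 S.dom) (hR : S.RegimeTok)
    (h𝒢 : AnalyticOnNhd ℂ (fun u => S.𝒢 (γ u)) 𝒪)
    (hW : AnalyticOnNhd ℂ (fun p : 𝒰 × 𝒴 => S.W (γ p.1) p.2) (𝒪 ×ˢ {Y : 𝒴 | ‖Y‖ < S.a₃}))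
    (hJ : AnalyticOnNhd ℂ (fun u => S.J (γ u)) 𝒪) (h𝔄 : AnalyticOnNhd ℂ (fun u => S.𝔄 (γ u)) 𝒪) :
    AnalyticOnNhd ℂ (fun u => S.sol (γ u) + S.𝔄 (γ u)) 𝒪 :=
  (analyticOnNhd_sol_comp h𝒪 hγ hR h𝒢 hW hJ h𝔄).add h𝔄

end BgScheme

end Literature.MathematicalPhysics.QuantumFieldTheory.Balaban1983to89.Node00
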